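import Summits.ResolutionOfSingularities.ResolutionOfSingularities.Theorems.LightCutLaw
import HarnessLib

/-!
# LightCutLaw2 — decomp-res node «LightCut» (lens-6 g22, critic row 166), tree file 2/3 of the node

Content VERBATIM from the decomp-res lens-6 g22 node `HOME/decomp-res-lens-6/g22/LightCut.lean` rev 1 (pin 61988fc1;
= CLEARED rev 0 `4c811963` + hygiene h1;
HOME = run/shared/lean/pub/decomp-res; critic row 166 CLEARED DECIDED +1 · MAP 0; landing orders INBOX :684 / :690)
— provenance, critic text and the lens header
in full in the first file of the node, `LightCutLaw`.  Namespace `…Theorems.LightCutClasses`; `--supports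
stmt-ResolutionOfSingularities-26971`; cone-free.

## This file

Continuation 2/2 of `LightCutLaw` (same section of the node, cut at the 400-line cap): carries `IsLight`, `LightAt`,
`noNearPointOver_of_lightAt`, `noNearPointOver_of_split_or_light`, `mapEquiv_layer`, `light_transport`,
`lightAt_transform_iff_of_not_mem`, `splitOrLight_transform_iff_of_not_mem`, `NearPointFree`,
`nearPointFree_diffSplit`, `nearPointFree_light`, `nearPointFree_splitOrLight`, `isDatum_transform_point'`,
`wild_transform'`, `elimination_aux'`, `eq_singleton_of_isIrreducible'`.

[WRITER NOTE (decomp-res writer g10): file split only (tree files ≤ 400 lines); namespace, universe, sections,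
section variables / opens and every
declaration exactly as in the lens (the lens's global dupNamespace-linter line is dropped — the library sets it;
`set_option … in` prefixes of single declarations are kept).]

(Sources: Hironaka 1967 (characteristic polyhedra); CossartJannsenSaito2020 Def. 3.13 / Thm. 3.14 (p. 129) / Thm.
9.6 (p. 136); CossartPiltant2008 §2; Giraud1975; EGAIV4 §16; StacksProject 0804 / 0BIQ; DeJong1996 2.4;
ZariskiSamuel1960 VIII §1; Matsumura1987 §14/§17.)
-/

noncomputable section

open CategoryTheory AlgebraicGeometry TopologicalSpace IsLocalRing
open Literature.AlgebraicGeometry.Resolution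

universe u

namespace Summit.ResolutionOfSingularities.ResolutionOfSingularities.Theorems.LightCutClasses

open Summit.ResolutionOfSingularities.ResolutionOfSingularities.Theorems.TwistCutClasses

section Predicate

/-! ## §3 The point predicate `LightAt`, the law at marked-ideal level, transports -/

/-- **`IsLight n J`** (ring level, `A` local): for some regular system of parameters `c` of `A` (`|c| = edim A`), some
`f ∈ J`, an index `i₀`, a UNIT `a` and a degree-`(n+1)` layer `Σ_{e ∈ E} b_e c^e` with
`f ≡ a c_{i₀}^n + Σ b_e c^e (mod 𝔪^{n+2})`, the reduced layer `Ḡ₁ = Σ b̄_e T^{e|_{j≠i}} ∈ κ(A)[T_j : j ≠ i]` is LIGHT in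
every chart `i ≠ i₀`: no prime `𝔮 ∋ T_{i₀}` has `s Ḡ₁ ∈ 𝔮^{n-1}` with `s ∉ 𝔮` (multiplicity of the layer `≤ n − 2` at every
point of the directrix hyperplane of the exceptional divisor). DEFINITION (support). -/
def IsLight {A : Type*} [CommRing A] [IsLocalRing A] (n : ℕ) (J : Ideal A) : Prop :=
  ∃ (d : ℕ) (c : Fin d → A), (maximalIdeal A).spanFinrank = d ∧ Ideal.span (Set.range c) = maximalIdeal A ∧
    ∃ f ∈ J, ∃ (i₀ : Fin d) (a : A) (E : Finset (Fin d → ℕ)) (b : (Fin d → ℕ) → A),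
      a ∉ maximalIdeal A ∧ (∀ e ∈ E, ∑ j, e j = n + 1) ∧
      f - a * c i₀ ^ n - ∑ e ∈ E, b e * ∏ j, c j ^ e j ∈ maximalIdeal A ^ (n + 2) ∧
      ∀ (i : Fin d) (hi : i₀ ≠ i) (𝔮 : Ideal (MvPolynomial {j : Fin d // j ≠ i} (ResidueField A))), 𝔮.IsPrime →
        MvPolynomial.X (⟨i₀, hi⟩ : {j : Fin d // j ≠ i}) ∈ 𝔮 → ∀ s ∉ 𝔮,
          s * (∑ e ∈ E, MvPolynomial.monomial (restrictExp i e) (residue A (b e))) ∉ 𝔮 ^ (n - 1)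

/-- **`LightAt 𝓘 n y` — THE POINT IS LIGHT** (NEW sub-cell predicate of lens-6, second-face axis): the stalk `𝓘_y` is light
at marking `n` in `𝒪_{Y,y}` (`IsLight`).  DEFINITION (support). -/
def LightAt {Y : Scheme.{0}} (I : Y.IdealSheafData) (n : ℕ) (y : Y) : Prop :=
  IsLight n (stalkIdeal I y)

open Summit.ResolutionOfSingularities.ResolutionOfSingularities.Theorems
open WeakOrderReduction ForcedTowerClasses SubfieldContactClasses AbsoluteContactClasses PurityValveClasses

/-- **KERNEL (PROVED, every characteristic, every field): LIGHT ⟹ NO NEAR POINT** — the light law at the level of marked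
ideals. [new] [folklore] -/
theorem noNearPointOver_of_lightAt {Y : Scheme.{0}} (hY : Scheme.IsRegular Y) {n : ℕ} (hn : 1 ≤ n)
    (M : MarkedIdeal Y) (hM : M.mult = n) {y : Y} (hyc : IsClosed ({y} : Set Y)) (hl : LightAt M.ideal n y) :
    NoNearPointOver M y := by
  intro C Y' π hpt hCreg hπ y' hy' hmem
  subst hy'
  obtain ⟨d, c, hd, hc, f, hfI, i₀, a, E, b, ha, hE, hfa, hlight⟩ := hl
  rw [MarkedIdeal.mem_support_iff, MarkedIdeal.transform_ideal, MarkedIdeal.transform_mult, hM] at hmem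
  exact not_near_of_light hπ hY hCreg M.ideal y' hyc hpt c hd hc hn hfI i₀ a ha E hE b hfa hlight hmem

/-- A light or split wild point has no near point. [new] [folklore] -/
theorem noNearPointOver_of_split_or_light {Y : Scheme.{0}} (hY : Scheme.IsRegular Y) {n : ℕ} (hn : 1 ≤ n)
    (M : MarkedIdeal Y) (hM : M.mult = n) {y : Y} (hyc : IsClosed ({y} : Set Y))
    (h : DiffSplitAt M.ideal n y ∨ LightAt M.ideal n y) : NoNearPointOver M y :=
  h.elim (noNearPointOver_of_diffSplitAt hY hn M hM hyc) (noNearPointOver_of_lightAt hY hn M hM hyc)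

end Predicate

section Transport3

variable {A B : Type*} [CommRing A] [CommRing B] [IsLocalRing A] [IsLocalRing B]

/-- The reduced layer is functorial in the residue-field isomorphism. [folklore] -/
theorem mapEquiv_layer (e : A ≃+* B) {d : ℕ} (i : Fin d) (E : Finset (Fin d → ℕ)) (b : (Fin d → ℕ) → A) :
    MvPolynomial.mapEquiv {j : Fin d // j ≠ i} (residueMapEquiv e)
        (∑ x ∈ E, MvPolynomial.monomial (restrictExp i x) (residue A (b x))) =
      ∑ x ∈ E, MvPolynomial.monomial (restrictExp i x) (residue B (e (b x))) := by
  rw [map_sum]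
  refine Finset.sum_congr rfl fun x _ => ?_
  rw [MvPolynomial.mapEquiv_apply, MvPolynomial.map_monomial]
  rfl

/-- Ring-level LIGHT predicate transported along a ring isomorphism of local rings. [folklore] -/
theorem light_transport (e : A ≃+* B) (n : ℕ) {J : Ideal A} (h : IsLight n J) : IsLight n (J.map e) := by
  classical
  obtain ⟨d, c, hd, hc, f, hfJ, i₀, a, E, b, ha, hE, hfa, hlight⟩ := h
  refine ⟨d, fun j => e (c j), ?_, ?_, e f, Ideal.mem_map_of_mem _ hfJ, i₀, e a, E, fun x => e (b x), ?_, hE, ?_, ?_⟩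
  · rw [← map_ringEquiv_maximalIdeal e, Ideal.spanFinrank_map_eq_of_ringEquiv, hd]
  · rw [← map_ringEquiv_maximalIdeal e, ← hc, Ideal.map_span, ← Set.range_comp]; rfl
  · rw [← map_ringEquiv_maximalIdeal e, mem_map_iff_of_equiv]; exact ha
  · have h1 : e (f - a * c i₀ ^ n - ∑ x ∈ E, b x * ∏ j, c j ^ x j) ∈ (maximalIdeal A ^ (n + 2)).map e :=
      Ideal.mem_map_of_mem _ hfa
    rw [Ideal.map_pow, map_ringEquiv_maximalIdeal e] at h1
    simpa [map_sub, map_sum, map_mul, map_prod, map_pow] using h1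
  · intro i hi 𝔮' h𝔮' hX' s' hs' hmem'
    obtain ⟨ρ, hρ⟩ : ∃ ρ : MvPolynomial {j : Fin d // j ≠ i} (ResidueField A) ≃+*
        MvPolynomial {j : Fin d // j ≠ i} (ResidueField B), ρ = MvPolynomial.mapEquiv _ (residueMapEquiv e) := ⟨_, rfl⟩
    have hρG : ρ (∑ x ∈ E, MvPolynomial.monomial (restrictExp i x) (residue A (b x))) =
        ∑ x ∈ E, MvPolynomial.monomial (restrictExp i x) (residue B (e (b x))) := by
      rw [hρ]; exact mapEquiv_layer e i E b
    have hρX : ρ (MvPolynomial.X ⟨i₀, hi⟩) = MvPolynomial.X ⟨i₀, hi⟩ := by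
      rw [hρ, MvPolynomial.mapEquiv_apply, MvPolynomial.map_X]
    obtain ⟨𝔮, h𝔮⟩ : ∃ 𝔮 : Ideal (MvPolynomial {j : Fin d // j ≠ i} (ResidueField A)), 𝔮 = 𝔮'.map (ρ.symm : _ →+* _) :=
      ⟨_, rfl⟩
    haveI : 𝔮.IsPrime := by rw [h𝔮]; exact Ideal.map_isPrime_of_equiv _
    have hX : MvPolynomial.X (⟨i₀, hi⟩ : {j : Fin d // j ≠ i}) ∈ 𝔮 := by
      rw [h𝔮, ← ρ.symm_apply_apply (MvPolynomial.X _), hρX]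
      exact (mem_map_iff_of_equiv ρ.symm _ _).2 hX'
    have hs : ρ.symm s' ∉ 𝔮 := by
      rw [h𝔮]; exact fun h => hs' ((mem_map_iff_of_equiv ρ.symm _ _).1 h)
    refine hlight i hi 𝔮 inferInstance hX _ hs ?_
    rw [← ρ.symm_apply_apply (∑ x ∈ E, _), hρG, ← map_mul, h𝔮, ← Ideal.map_pow]
    exact (mem_map_iff_of_equiv ρ.symm _ _).2 hmem'

end Transport3

section OffCentre

open Summit.ResolutionOfSingularities.ResolutionOfSingularities.Theorems
open WeakOrderReduction ForcedTowerClasses SubfieldContactClasses AbsoluteContactClasses PurityValveClasses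
variable {Y Y' : Scheme.{0}} {π : Y' ⟶ Y} {C : Y.IdealSheafData}

/-- OFF-CENTRE INVARIANCE of lightness. [folklore] -/
theorem lightAt_transform_iff_of_not_mem (hπ : IsBlowup π C) (I : Y.IdealSheafData) (b n : ℕ) {y' : Y'}
    (hy : π.base y' ∉ (C.support : Set Y)) :
    LightAt (controlledTransform π C I b) n y' ↔ LightAt I n (π.base y') := by
  obtain ⟨e, he⟩ := exists_stalkEquiv_of_not_mem hπ I b hy
  unfold LightAt
  rw [he]
  refine ⟨fun h => ?_, fun h => light_transport e n h⟩
  have h' := light_transport e.symm n h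
  rwa [Summit.ResolutionOfSingularities.ResolutionOfSingularities.Theorems.CampaignW46.map_map_symm_of_equiv] at h'

/-- OFF-CENTRE INVARIANCE of «split or light». [folklore] -/
theorem splitOrLight_transform_iff_of_not_mem (hπ : IsBlowup π C) (I : Y.IdealSheafData) (b n : ℕ) {y' : Y'}
    (hy : π.base y' ∉ (C.support : Set Y)) :
    (DiffSplitAt (controlledTransform π C I b) n y' ∨ LightAt (controlledTransform π C I b) n y') ↔
      (DiffSplitAt I n (π.base y') ∨ LightAt I n (π.base y')) := by
  rw [diffSplitAt_transform_iff_of_not_mem hπ I b n hy, lightAt_transform_iff_of_not_mem hπ I b n hy]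

end OffCentre

section GeneralElimination

open Summit.ResolutionOfSingularities.ResolutionOfSingularities.Theorems
open WeakOrderReduction ForcedTowerClasses SubfieldContactClasses AbsoluteContactClasses PurityValveClasses
open Scheme.IdealSheafData (vanishingIdeal)

/-! ## §4 GENERALISED ELIMINATION: any near-point-free, off-centre-transportable point predicate `P`
(refactor of the tree's §11–§12 `elimination_aux` / `eq_singleton_of_isIrreducible` / `wildSplitFinite_of_orderUSC`,
which are the instance `P = DiffSplitAt · n`) -/

/-- **`NearPointFree n P`**: the point predicate `P 𝓘 y` (i) forces `NoNearPointOver M y` at closed points of regular schemes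
for marked ideals of multiplicity `n`, and (ii) is invariant off the centre of any blow-up (for the controlled
transform with any
control).  Instances: `DiffSplitAt · n` (tree, twist law), `LightAt · n` (light law), their disjunction. DEFINITION
(support). -/
def NearPointFree (n : ℕ) (P : ∀ ⦃Y : Scheme.{0}⦄, Y.IdealSheafData → Y → Prop) : Prop :=
  (∀ ⦃Y : Scheme.{0}⦄, Scheme.IsRegular Y → ∀ M : MarkedIdeal Y, M.mult = n → ∀ ⦃y : Y⦄, IsClosed ({y} : Set Y) →
      P M.ideal y → NoNearPointOver M y) ∧
    ∀ ⦃Y Y' : Scheme.{0}⦄ ⦃π : Y' ⟶ Y⦄ ⦃C : Y.IdealSheafData⦄, IsBlowup π C → ∀ (I : Y.IdealSheafData) (b : ℕ)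
      ⦃y' : Y'⦄, π.base y' ∉ (C.support : Set Y) → (P (controlledTransform π C I b) y' ↔ P I (π.base y'))

/-- `DiffSplitAt · n` is near-point-free (the twist law + off-centre invariance, tree). [folklore] -/
theorem nearPointFree_diffSplit {n : ℕ} (hn : 1 ≤ n) : NearPointFree n (fun _ I y => DiffSplitAt I n y) :=
  ⟨fun _ hY M hM _ hyc hs => noNearPointOver_of_diffSplitAt hY hn M hM hyc hs,
    fun _ _ _ _ hπ I b _ hy => diffSplitAt_transform_iff_of_not_mem hπ I b n hy⟩

/-- `LightAt · n` is near-point-free (the light law + off-centre invariance). [new] [folklore] -/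
theorem nearPointFree_light {n : ℕ} (hn : 1 ≤ n) : NearPointFree n (fun _ I y => LightAt I n y) :=
  ⟨fun _ hY M hM _ hyc hs => noNearPointOver_of_lightAt hY hn M hM hyc hs,
    fun _ _ _ _ hπ I b _ hy => lightAt_transform_iff_of_not_mem hπ I b n hy⟩

/-- «split or light» is near-point-free. [new] [folklore] -/
theorem nearPointFree_splitOrLight {n : ℕ} (hn : 1 ≤ n) :
    NearPointFree n (fun _ I y => DiffSplitAt I n y ∨ LightAt I n y) :=
  ⟨fun _ hY M hM _ hyc hs => noNearPointOver_of_split_or_light hY hn M hM hyc hs,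
    fun _ _ _ _ hπ I b _ hy => splitOrLight_transform_iff_of_not_mem hπ I b n hy⟩

variable {Y Y' : Scheme.{0}} {π : Y' ⟶ Y} {C : Y.IdealSheafData}

/-- THE POINT STEP for a near-point-free closed top point: blowing it up keeps `IsDatum n` and leaves no point of the
support over it. [folklore; tree `isDatum_transform_point` with the law abstracted] [folklore] -/
theorem isDatum_transform_point' (hπ : IsBlowup π C) {n : ℕ} {M : MarkedIdeal Y} (hM : IsDatum n M) {y₀ : Y}
    (hCsupp : (C.support : Set Y) = {y₀}) (hCreg : Scheme.IsRegular C.subscheme) (hs : NoNearPointOver M y₀) :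
    IsDatum n (M.transform π C) ∧ ∀ y' : Y', π.base y' = y₀ → y' ∉ (M.transform π C).support := by
  have hno : ∀ y' : Y', π.base y' = y₀ → y' ∉ (M.transform π C).support :=
    fun y' hy' => hs C Y' π hCsupp hCreg hπ y' hy'
  refine ⟨⟨by rw [MarkedIdeal.transform_mult, hM.1], fun y' => ?_⟩, hno⟩
  by_cases hy' : π.base y' = y₀
  · have h1 : ¬ (((M.transform π C).mult : ℕ∞) ≤ idealOrder (M.transform π C).ideal y') := hno y' hy'
    rw [MarkedIdeal.transform_mult, hM.1] at h1
    exact le_of_lt (not_le.mp h1)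
  · have hy'C : π.base y' ∉ (C.support : Set Y) := by rw [hCsupp]; exact hy'
    rw [MarkedIdeal.transform_ideal, hπ.idealOrder_controlledTransform_of_not_mem M.ideal M.mult hy'C]
    exact hM.2 _

/-- After the point step at a near-point-free point, every wild point upstairs lies over a wild point downstairs other than
the centre, and inherits `P`. [folklore; tree `wild_transform` abstracted] [folklore] -/
theorem wild_transform' {P : ∀ ⦃Y : Scheme.{0}⦄, Y.IdealSheafData → Y → Prop} {n : ℕ} (hP : NearPointFree n P)
    (hπ : IsBlowup π C) [IsLocallyNoetherian Y] {M : MarkedIdeal Y} (hM : IsDatum n M) {y₀ : Y}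
    (hCsupp : (C.support : Set Y) = {y₀}) (hCreg : Scheme.IsRegular C.subscheme) (hs : NoNearPointOver M y₀)
    {y' : Y'} (hw : y' ∈ wildSet (M.transform π C) n) :
    π.base y' ∉ (C.support : Set Y) ∧ π.base y' ∈ wildSet M n \ {y₀} ∧
      (P M.ideal (π.base y') → P (M.transform π C).ideal y') := by
  obtain ⟨hcl, hord, hna⟩ := hw
  have hne : π.base y' ≠ y₀ := by
    intro h
    apply (isDatum_transform_point' hπ hM hCsupp hCreg hs).2 y' h
    show ((M.transform π C).mult : ℕ∞) ≤ idealOrder (M.transform π C).ideal y'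
    rw [MarkedIdeal.transform_mult, hM.1, hord]
  have hy'C : π.base y' ∉ (C.support : Set Y) := by rw [hCsupp]; exact hne
  haveI := hπ.isProper
  refine ⟨hy'C, ⟨⟨?_, ?_, ?_⟩, hne⟩, fun hsp => ?_⟩
  · have := π.isClosedMap _ hcl
    rwa [Set.image_singleton] at this
  · rw [← hπ.idealOrder_controlledTransform_of_not_mem M.ideal M.mult hy'C]; exact hord
  · rw [MarkedIdeal.transform_ideal, isAbsContactAt_transform_iff_of_not_mem hπ M.ideal M.mult n hy'C] at hna
    exact hna
  · rw [MarkedIdeal.transform_ideal, hP.2 hπ M.ideal M.mult hy'C]; exact hsp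

/-- **THE ELIMINATION INDUCTION for a near-point-free predicate** (PROVED modulo `BaseStable`, which the tree proves):
finitely many `P`-points of the wild set are removed one point blow-up at a time. [folklore; tree `elimination_aux`
abstracted] [folklore] -/
theorem elimination_aux' {P : ∀ ⦃Y : Scheme.{0}⦄, Y.IdealSheafData → Y → Prop} {n : ℕ} (hP : NearPointFree n P)
    (hBS : BaseStable) {k : Type} [Field k] :
    ∀ (N : ℕ) (Y : Scheme.{0}) (g : Y ⟶ Spec (.of k)), IsBase Y g → ∀ M : MarkedIdeal Y, IsDatum n M →
      (wildSet M n).Finite → (wildSet M n).ncard ≤ N → (∀ y ∈ wildSet M n, P M.ideal y) →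
      ∃ t : CentreSeq Y, WeakAdmissible t M ∧ ∃ _ : IsBase t.top (t.comp ≫ g),
        IsDatum n (t.transformMarked M) ∧ wildSet (t.transformMarked M) n = ∅
  | 0, Y, g, hB, M, hM, hfin, hcard, _ => by
    have hempty : wildSet M n = ∅ := (Set.ncard_eq_zero hfin).mp (Nat.le_zero.mp hcard)
    refine ⟨CentreSeq.nil Y, trivial, ?_, hM, hempty⟩
    show IsBase Y (𝟙 Y ≫ g)
    simpa using hB
  | N + 1, Y, g, hB, M, hM, hfin, hcard, hsplit => by
    by_cases hempty : wildSet M n = ∅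
    · refine ⟨CentreSeq.nil Y, trivial, ?_, hM, hempty⟩
      show IsBase Y (𝟙 Y ≫ g)
      simpa using hB
    obtain ⟨y₀, hy₀⟩ := Set.nonempty_iff_ne_empty.mpr hempty
    have hy₀c : IsClosed ({y₀} : Set Y) := hy₀.1
    haveI := hB.locallyOfFiniteType
    haveI : IsLocallyNoetherian Y := LocallyOfFiniteType.isLocallyNoetherian g
    -- the point centre
    have hCsupp : ((vanishingIdeal ⟨{y₀}, hy₀c⟩ : Y.IdealSheafData).support : Set Y) = {y₀} :=
      coe_support_vanishingIdeal_singleton hy₀c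
    have hCreg : Scheme.IsRegular (vanishingIdeal ⟨{y₀}, hy₀c⟩ : Y.IdealSheafData).subscheme :=
      isRegular_subscheme_vanishingIdeal_singleton hy₀c
    have hCsub : ((vanishingIdeal ⟨{y₀}, hy₀c⟩ : Y.IdealSheafData).support : Set Y) ⊆ M.support := by
      rw [hCsupp, Set.singleton_subset_iff]
      show (M.mult : ℕ∞) ≤ idealOrder M.ideal y₀
      rw [hM.1, hy₀.2.1]
    have hπ := blowup.isBlowup (vanishingIdeal ⟨{y₀}, hy₀c⟩ : Y.IdealSheafData)
    have hB₁ : IsBase (blowup (vanishingIdeal ⟨{y₀}, hy₀c⟩ : Y.IdealSheafData))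
        (blowup.π (vanishingIdeal ⟨{y₀}, hy₀c⟩ : Y.IdealSheafData) ≫ g) := hBS k Y g hB _ hCreg
    have hs₀ : NoNearPointOver M y₀ := hP.1 hB.isRegular M hM.1 hy₀c (hsplit y₀ hy₀)
    obtain ⟨hM₁, -⟩ := isDatum_transform_point' hπ hM hCsupp hCreg hs₀
    have hwt := fun y' (hw : y' ∈ wildSet (M.transform (blowup.π (vanishingIdeal ⟨{y₀}, hy₀c⟩ : Y.IdealSheafData))
        (vanishingIdeal ⟨{y₀}, hy₀c⟩)) n) => wild_transform' hP hπ hM hCsupp hCreg hs₀ hw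
    have hinj : Set.InjOn (blowup.π (vanishingIdeal ⟨{y₀}, hy₀c⟩ : Y.IdealSheafData)).base
        (wildSet (M.transform (blowup.π (vanishingIdeal ⟨{y₀}, hy₀c⟩ : Y.IdealSheafData))
          (vanishingIdeal ⟨{y₀}, hy₀c⟩)) n) :=
      (injOn_of_isBlowup hπ).mono fun y' hw => (hwt y' hw).1
    have hmaps : ∀ y' ∈ wildSet (M.transform (blowup.π (vanishingIdeal ⟨{y₀}, hy₀c⟩ : Y.IdealSheafData))
        (vanishingIdeal ⟨{y₀}, hy₀c⟩)) n,
        (blowup.π (vanishingIdeal ⟨{y₀}, hy₀c⟩ : Y.IdealSheafData)).base y' ∈ wildSet M n \ {y₀} :=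
      fun y' hw => (hwt y' hw).2.1
    have hfin₀ : (wildSet M n \ {y₀}).Finite := hfin.sdiff
    have hfin₁ : (wildSet (M.transform (blowup.π (vanishingIdeal ⟨{y₀}, hy₀c⟩ : Y.IdealSheafData))
        (vanishingIdeal ⟨{y₀}, hy₀c⟩)) n).Finite :=
      Set.Finite.of_finite_image (hfin₀.subset (Set.image_subset_iff.mpr fun y' hw => hmaps y' hw)) hinj
    have hcard₁ : (wildSet (M.transform (blowup.π (vanishingIdeal ⟨{y₀}, hy₀c⟩ : Y.IdealSheafData))
        (vanishingIdeal ⟨{y₀}, hy₀c⟩)) n).ncard ≤ N := by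
      have h1 := Set.ncard_le_ncard_of_injOn _ hmaps hinj hfin₀
      rw [Set.ncard_sdiff_singleton_of_mem hy₀] at h1
      omega
    have hsplit₁ : ∀ y' ∈ wildSet (M.transform (blowup.π (vanishingIdeal ⟨{y₀}, hy₀c⟩ : Y.IdealSheafData))
        (vanishingIdeal ⟨{y₀}, hy₀c⟩)) n, P (M.transform (blowup.π (vanishingIdeal ⟨{y₀}, hy₀c⟩ :
          Y.IdealSheafData)) (vanishingIdeal ⟨{y₀}, hy₀c⟩)).ideal y' :=
      fun y' hw => (hwt y' hw).2.2 (hsplit _ (hmaps y' hw).1)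
    obtain ⟨t₁, hadm₁, hB₁', hM₁', hempty₁⟩ :=
      elimination_aux' hP hBS N _ _ hB₁ _ hM₁ hfin₁ hcard₁ hsplit₁
    refine ⟨CentreSeq.cons _ t₁, ⟨hCsub, hCreg, hadm₁⟩, ?_, hM₁', hempty₁⟩
    show IsBase _ ((t₁.comp ≫ blowup.π _) ≫ g)
    simpa [Category.assoc] using hB₁'

/-- **ISOLATION OF NEAR-POINT-FREE WILD POINTS** (PROVED modulo `OrderUSC` and `BaseStable`, both tree theorems): an
irreducible closed subset of the top locus through a near-point-free closed top point is that point. [folklore; tree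
`eq_singleton_of_isIrreducible` abstracted] [folklore] -/
theorem eq_singleton_of_isIrreducible' (hU : OrderUSC) (hBS : BaseStable) {k : Type} [Field k] {Y : Scheme.{0}}
    {g : Y ⟶ Spec (.of k)} (hB : IsBase Y g) {n : ℕ} {M : MarkedIdeal Y} (hM : IsDatum n M) {y₀ : Y}
    (hy₀c : IsClosed ({y₀} : Set Y)) (hs : NoNearPointOver M y₀) {Z : Set Y} (hZ : IsIrreducible Z)
    (hZc : IsClosed Z) (hZT : Z ⊆ M.support) (hy₀Z : y₀ ∈ Z) : Z = {y₀} := by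
  haveI := hB.locallyOfFiniteType
  haveI : IsLocallyNoetherian Y := LocallyOfFiniteType.isLocallyNoetherian g
  have hCsupp : ((vanishingIdeal ⟨{y₀}, hy₀c⟩ : Y.IdealSheafData).support : Set Y) = {y₀} :=
    coe_support_vanishingIdeal_singleton hy₀c
  have hCreg : Scheme.IsRegular (vanishingIdeal ⟨{y₀}, hy₀c⟩ : Y.IdealSheafData).subscheme :=
    isRegular_subscheme_vanishingIdeal_singleton hy₀c
  have hπ := blowup.isBlowup (vanishingIdeal ⟨{y₀}, hy₀c⟩ : Y.IdealSheafData)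
  haveI := hπ.isProper
  have hB₁ := hBS k Y g hB _ hCreg
  obtain ⟨-, hno⟩ := isDatum_transform_point' hπ hM hCsupp hCreg hs
  by_contra hne
  have hζ : IsGenericPoint hZ.genericPoint Z := hZ.isGenericPoint_genericPoint hZc
  have hζne : hZ.genericPoint ≠ y₀ := by
    intro h
    apply hne
    rw [← hζ.def, h, hy₀c.closure_eq]
  have hζC : hZ.genericPoint ∉ ((vanishingIdeal ⟨{y₀}, hy₀c⟩ : Y.IdealSheafData).support : Set Y) := by
    rw [hCsupp]; exact hζne
  obtain ⟨ζ', hζ'⟩ := exists_preimage_of_not_mem hπ hζC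
  have hζ'C : (blowup.π (vanishingIdeal ⟨{y₀}, hy₀c⟩ : Y.IdealSheafData)).base ζ' ∉
      ((vanishingIdeal ⟨{y₀}, hy₀c⟩ : Y.IdealSheafData).support : Set Y) := by rw [hζ']; exact hζC
  have hord : ((n : ℕ) : ℕ∞) ≤ idealOrder (M.transform (blowup.π (vanishingIdeal ⟨{y₀}, hy₀c⟩ : Y.IdealSheafData))
      (vanishingIdeal ⟨{y₀}, hy₀c⟩)).ideal ζ' := by
    rw [MarkedIdeal.transform_ideal, hπ.idealOrder_controlledTransform_of_not_mem M.ideal M.mult hζ'C, hζ', ← hM.1]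
    exact hZT hζ.mem
  have hcl : IsClosed ((blowup.π (vanishingIdeal ⟨{y₀}, hy₀c⟩ : Y.IdealSheafData)).base '' closure {ζ'}) :=
    (blowup.π _).isClosedMap _ isClosed_closure
  have hZsub : Z ⊆ (blowup.π (vanishingIdeal ⟨{y₀}, hy₀c⟩ : Y.IdealSheafData)).base '' closure {ζ'} := by
    rw [← hζ.def]
    exact closure_minimal (Set.singleton_subset_iff.mpr ⟨ζ', subset_closure rfl, hζ'⟩) hcl
  obtain ⟨y', hy'cl, hy'⟩ := hZsub hy₀Z
  have hT₁ := hU k _ _ hB₁ (M.transform (blowup.π (vanishingIdeal ⟨{y₀}, hy₀c⟩ : Y.IdealSheafData))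
      (vanishingIdeal ⟨{y₀}, hy₀c⟩)).ideal n
  have hy'T : ((n : ℕ) : ℕ∞) ≤ idealOrder (M.transform (blowup.π (vanishingIdeal ⟨{y₀}, hy₀c⟩ : Y.IdealSheafData))
      (vanishingIdeal ⟨{y₀}, hy₀c⟩)).ideal y' :=
    (closure_minimal (t := {y | ((n : ℕ) : ℕ∞) ≤ idealOrder (M.transform (blowup.π (vanishingIdeal ⟨{y₀}, hy₀c⟩ :
      Y.IdealSheafData)) (vanishingIdeal ⟨{y₀}, hy₀c⟩)).ideal y}) (Set.singleton_subset_iff.mpr hord) hT₁) hy'cl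
  apply hno y' hy'
  show ((M.transform _ _).mult : ℕ∞) ≤ _
  rw [MarkedIdeal.transform_mult, hM.1]
  exact hy'T

end GeneralElimination

end Summit.ResolutionOfSingularities.ResolutionOfSingularities.Theorems.LightCutClasses
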